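import Summits.Ventures.PercRepro.ProfileGapMonoThresholdComplement

/-!
# PercRepro — THE BAND CASE `u = q + 1` FROM A SINGLE RULE INSTANCE (p5, gen 24; `proofs/P5-GM1.md` §24;
announced INBOX 12023)

The inner induction on `#E` for the ONE threshold `t = q + 1` needs the rule on the hard class only at `(q, q+1)`:
the coloop case asks for `(I_q)` of the deletion — the row `(q−1, q)`, by `thresholdIneq_pred_iff` — and for
`(I_{q+1})` one co-rank down; loops, parallel points and `q`-generic points reduce as before.  At co-rank `3` both
inputs are theorems (`thresholdIneq_two`, `thresholdIneq_three_three`), so the first hard instance of the coloop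
band case — `(★_3)` at `u = 4`, i.e. `(GM)_3` at every coloop at the level `4` — rests on the single instance
`HardRuleT α 3 4`.

* `thresholdIneq_succ_of_hardRuleT_aux`, **`thresholdIneq_succ_of_hardRuleT`**,
  **`thresholdIneq_three_four_of_hardRuleT`**, **`starQ_three_four_of_rule`**, **`gapMonoQ_coloop_three_four_of_rule`**.
-/

open scoped Matroid

namespace PercRepro.Cogirth

open Finset ThmH Skew Shadow Profile

variable {α : Type} [DecidableEq α] {M : Matroid α} [M.Finite]

section Succ

/-- The inner induction on `#E` for the single threshold `t = q + 1` (`2 ≤ q`): the family one co-rank down, the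
row `(q−1, q)` in its offset-`0` form, and the rule on the hard class at `(q, q+1)` only. -/
theorem thresholdIneq_succ_of_hardRuleT_aux {q : ℕ} (hq : 2 ≤ q)
    (hprev : ∀ (K : Matroid α) [K.Finite] (t' : ℕ), q - 1 ≤ t' → ThresholdIneq K (q - 1) t')
    (hrow : ∀ (K : Matroid α) [K.Finite], ThresholdIneq K q q)
    (hrule : HardRuleT α q (q + 1)) (n : ℕ) :
    ∀ (N : Matroid α) [N.Finite], (gr N).card = n → ThresholdIneq N q (q + 1) := by
  induction n using Nat.strong_induction_on with
  | _ n ih =>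
  intro N _ hN
  have ihdel : ∀ z ∈ gr N, ThresholdIneq (N ＼ ({z} : Set α)) q (q + 1) := by
    intro z hz
    have hlt : ((gr N).erase z).card < n := by rw [← hN]; exact card_erase_lt_of_mem hz
    exact ih _ hlt (N ＼ ({z} : Set α)) (by rw [gr_delete'])
  rcases (gr N).eq_empty_or_nonempty with hempty | hne
  · exact thresholdIneq_of_card_eq_zero (by rw [hempty, card_empty])
  -- a loop
  by_cases hloop : ∃ ℓ ∈ gr N, rk N {ℓ} = 0
  · obtain ⟨ℓ, hℓ, h0⟩ := hloop
    exact thresholdIneq_of_loop hℓ h0 (ihdel ℓ hℓ)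
  -- a parallel pair
  by_cases hpar : ∃ z ∈ gr N, ∃ z' ∈ gr N, z ≠ z' ∧ rk N {z, z'} = 1
  · obtain ⟨z, hz, z', hz', hzz', hpar⟩ := hpar
    have hz1 : rk N {z} = 1 := by
      have h1 := rk_mono' (M := N) (show ({z} : Finset α) ⊆ {z, z'} by simp)
      have h2 : rk N {z} ≠ 0 := fun h => hloop ⟨z, hz, h⟩
      omega
    have hz'1 : rk N {z'} = 1 := by
      have h1 := rk_mono' (M := N) (show ({z'} : Finset α) ⊆ {z, z'} by simp)
      have h2 : rk N {z'} ≠ 0 := fun h => hloop ⟨z', hz', h⟩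
      omega
    have hdm := delMonoT_of_parallel hz hz' hzz' hz1 hz'1 hpar hq (by omega)
      (hprev _ (q + 1 - 1) (by omega))
    exact thresholdIneq_of_delMonoT hdm (ihdel z hz)
  -- a coloop
  by_cases hcol : ∃ z ∈ gr N, rk N ((gr N).erase z) + 1 = rk N (gr N)
  · obtain ⟨z, hz, hzc⟩ := hcol
    have h1 : ThresholdIneq (N ＼ ({z} : Set α)) q (q + 1 - 1) := by
      rw [Nat.add_sub_cancel]
      exact hrow _
    exact thresholdIneq_of_coloop hz hzc hq (by omega) h1 (hprev _ (q + 1) (by omega))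
  -- a generic point
  by_cases hgen : ∃ z ∈ gr N, GenericQ N z q
  · obtain ⟨z, hz, hg⟩ := hgen
    have hz1 : rk N {z} = 1 := by
      have h2 : rk N {z} ≠ 0 := fun h => hloop ⟨z, hz, h⟩
      have h3 : rk N {z} ≤ 1 := by
        have := rk_le_card (M := N) ({z} : Finset α)
        simpa using this
      omega
    have hzI : N.Indep {z} := by
      have h := indep_of_rk_eq_card (M := N) (X := {z}) (by rw [card_singleton]; exact hz1)
      rwa [coe_singleton] at h
    have hdm := delMonoT_of_genericQ hzI hg hq (by omega) (hprev _ (q + 1 - 1) (by omega))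
    exact thresholdIneq_of_delMonoT hdm (ihdel z hz)
  -- the hard class: the rule
  have hhard : HardT N q := by
    refine ⟨?_, ?_, ?_, ?_⟩
    · intro x hx
      have h2 : rk N {x} ≠ 0 := fun h => hloop ⟨x, hx, h⟩
      have h3 : rk N {x} ≤ 1 := by
        have := rk_le_card (M := N) ({x} : Finset α)
        simpa using this
      omega
    · intro x hx y hy hxy h
      exact hpar ⟨x, hx, y, hy, hxy, h⟩
    · intro x hx h
      exact hcol ⟨x, hx, h⟩
    · intro x hx h
      exact hgen ⟨x, hx, h⟩
  obtain ⟨z, hz, hdm⟩ := hrule N hhard hne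
  exact thresholdIneq_of_delMonoT hdm (ihdel z hz)

/-- **The band case `(I_{q+1})` from the single rule instance `(q, q+1)`** (`2 ≤ q`), given the family one co-rank
down and the row `(q−1, q)` in its offset-`0` form. -/
theorem thresholdIneq_succ_of_hardRuleT {q : ℕ} (hq : 2 ≤ q)
    (hprev : ∀ (K : Matroid α) [K.Finite] (t' : ℕ), q - 1 ≤ t' → ThresholdIneq K (q - 1) t')
    (hrow : ∀ (K : Matroid α) [K.Finite], ThresholdIneq K q q)
    (hrule : HardRuleT α q (q + 1)) (N : Matroid α) [N.Finite] : ThresholdIneq N q (q + 1) :=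
  thresholdIneq_succ_of_hardRuleT_aux hq hprev hrow hrule _ N rfl

/-- **`(I_4)` at co-rank `3` from the single rule instance `HardRuleT α 3 4`** (co-rank `2` and the row `(2, 3)` are
theorems). -/
theorem thresholdIneq_three_four_of_hardRuleT (hrule : HardRuleT α 3 4) (N : Matroid α) [N.Finite] :
    ThresholdIneq N 3 4 :=
  thresholdIneq_succ_of_hardRuleT (q := 3) (by norm_num)
    (fun K _ t' ht' => thresholdIneq_two K (by omega)) (fun K _ => thresholdIneq_three_three K) hrule N

/-- **`(★_3)` at `u = 4` from the single rule instance `HardRuleT α 3 4`.** -/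
theorem starQ_three_four_of_rule {z : α} (hrule : HardRuleT α 3 4) : StarQ M z 3 4 :=
  (starQ_succ_iff_thresholdIneq (by norm_num)).2 (thresholdIneq_three_four_of_hardRuleT hrule _)

/-- **`(GM)_3` at every coloop at the level `u = 4` from the single rule instance `HardRuleT α 3 4`** — the first
hard instance of the coloop band case. -/
theorem gapMonoQ_coloop_three_four_of_rule {z : α} (hz : z ∈ gr M)
    (hzc : rk M ((gr M).erase z) + 1 = rk M (gr M)) (hrule : HardRuleT α 3 4) : GapMonoQ M z 3 4 := by
  have hrow : ProfileIneqMinusQ (M ＼ ({z} : Set α)) 3 (3 + 1 - 1) := by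
    rw [Nat.add_sub_cancel]
    exact profileIneqMinusQ_self _ 3
  exact gapMonoQ_of_coloop_of_starQ hz hzc (by norm_num) (by norm_num) hrow (starQ_three_four_of_rule hrule)

end Succ

end PercRepro.Cogirth
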